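import Summits.Ventures.HodgeRepro2.T5SU11JacobiWeight
import Mathlib.Algebra.Group.ForwardDiff

/-!
# Complete monotonicity of the Jacobi transform in the weight (Hausdorff–Bernstein–Widder form)

For fixed `λ` the Jacobi transform `m̂_k(λ) = ∫_G (1 − |g·0|²)^{k/2} φ_λ(g) dν` is the Laplace transform
`∫_G e^{−k s(g)} φ_λ(g) dν` of the positive measure `φ_λ dν` in the non-negative phase `s(g) = log|a(g)|`
(`T5SU11JacobiWeight`, `orbit_rpow_eq_exp`). This file records the property that characterises such
transforms (Hausdorff–Bernstein–Widder), in its derivative-free form: **every iterated forward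
difference alternates in sign**,

  `(−1)^n · Δ_h^n m̂_·(λ)(k) = ∫_G m_k(g) · (1 − m_h(g))^n · φ_λ(g) dν ≥ 0`,   `h ≥ 0`, `n ∈ ℕ`

(`jacobi_fwdDiff_iter_eq`, `jacobi_fwdDiff_iter_nonneg`), with `m_k(g) := (1 − |g·0|²)^{k/2} ∈ (0, 1]`
and `m_{k + j h} = m_k · m_h^j` (`orbit_rpow_add_nat_mul`) — the binomial identity
`∑_j (−1)^j C(n, j) x^j = (1 − x)^n` (`sum_neg_one_pow_choose_mul_pow`) under the integral — and STRICTLY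
so for `h > 0` (`jacobi_fwdDiff_iter_pos`: the integrand is positive off the `ν`-null rotation subgroup).
The orders `n = 1, 2` re-read as the monotonicity and the CONVEXITY of the transform in the weight
(`jacobi_second_difference_nonneg`, `convexOn_jacobi_weight` — the latter also from the log-convexity
of `T5SU11JacobiWeight` by the weighted AM–GM inequality). Nothing is claimed about (N).

Blind lane: Mathlib + the HodgeRepro2 prefix only; no sorry; axioms ⊆ {propext, Classical.choice,
Quot.sound}.
-/

namespace Summit.Ventures.HodgeRepro2.T5SU11JacobiCompleteMonotone

open MeasureTheory MeasureTheory.Measure Metric Set Filter Topology Finset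
open T5SU11Unimodular T5SU11Fibration T5SU11Cartan T5HaarCircle T5BergmanCoefficient
  T5SU11FibrationHaar T5SU11SphericalFunction T5SU11SphericalSymmetry T5SU11SphericalBounds
  T5SU11SphericalContinuous T5SU11JacobiIwasawa T5SU11JacobiTransform
  T5SU11KFiniteMajorantPow T5SU11OrbitMeasure T5SU11JacobiWeight
open scoped Real

/-! ### The binomial identity and the multiplicativity of the integrand in the weight -/

/-- `∑_{j ≤ n} (−1)^j C(n, j) x^j = (1 − x)^n`. -/
theorem sum_neg_one_pow_choose_mul_pow (x : ℝ) (n : ℕ) :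
    ∑ j ∈ range (n + 1), (-1 : ℝ) ^ j * (n.choose j : ℝ) * x ^ j = (1 - x) ^ n := by
  rw [show (1 : ℝ) - x = -x + 1 by ring, add_pow]
  refine Finset.sum_congr rfl fun j _ => ?_
  rw [neg_pow, one_pow, mul_one]
  ring

/-- `m_{k + h}(g) = m_k(g) · m_h(g)`. -/
theorem orbit_rpow_add (k h : ℝ) (g : SU11) :
    (1 - ‖orbit g‖ ^ 2) ^ ((k + h) / 2) = (1 - ‖orbit g‖ ^ 2) ^ (k / 2) * (1 - ‖orbit g‖ ^ 2) ^ (h / 2) := by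
  rw [add_div, Real.rpow_add (one_sub_norm_orbit_sq_pos g)]

/-- `m_{k + j h}(g) = m_k(g) · m_h(g)^j` for `j ∈ ℕ`. -/
theorem orbit_rpow_add_nat_mul (k h : ℝ) (j : ℕ) (g : SU11) :
    (1 - ‖orbit g‖ ^ 2) ^ ((k + j * h) / 2)
      = (1 - ‖orbit g‖ ^ 2) ^ (k / 2) * ((1 - ‖orbit g‖ ^ 2) ^ (h / 2)) ^ j := by
  rw [orbit_rpow_add, show (j : ℝ) * h / 2 = h / 2 * (j : ℝ) by ring,
    Real.rpow_mul (one_sub_norm_orbit_sq_pos g).le, Real.rpow_natCast]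

/-- `m_h(g) ≤ 1` for `h ≥ 0`. -/
theorem orbit_rpow_le_one {h : ℝ} (hh : 0 ≤ h) (g : SU11) : (1 - ‖orbit g‖ ^ 2) ^ (h / 2) ≤ 1 :=
  Real.rpow_le_one (one_sub_norm_orbit_sq_pos g).le (one_sub_norm_orbit_sq_le_one g) (by linarith)

/-- `m_h(g) < 1` for `h > 0` and `g·0 ≠ 0`. -/
theorem orbit_rpow_lt_one {h : ℝ} (hh : 0 < h) {g : SU11} (hg : orbit g ≠ 0) :
    (1 - ‖orbit g‖ ^ 2) ^ (h / 2) < 1 := by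
  have hlt : 1 - ‖orbit g‖ ^ 2 < 1 := by
    have := norm_pos_iff.mpr hg
    nlinarith
  exact Real.rpow_lt_one (one_sub_norm_orbit_sq_pos g).le hlt (by linarith)

/-! ### The iterated differences of the transform -/

section measure

variable [MeasurableSpace Circle] [BorelSpace Circle]

omit [BorelSpace Circle] in
/-- The pointwise form of the `n`-th difference: `∑_j (−1)^j C(n, j) m_{k + j h} φ_λ = m_k (1 − m_h)^n φ_λ`. -/
theorem sum_orbit_rpow_shift_eq (k h lam : ℝ) (n : ℕ) (g : SU11) :
    ∑ j ∈ range (n + 1), (-1 : ℝ) ^ j * (n.choose j : ℝ)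
        * ((1 - ‖orbit g‖ ^ 2) ^ ((k + j * h) / 2) * sph lam g)
      = (1 - ‖orbit g‖ ^ 2) ^ (k / 2) * (1 - (1 - ‖orbit g‖ ^ 2) ^ (h / 2)) ^ n * sph lam g := by
  rw [← sum_neg_one_pow_choose_mul_pow, Finset.mul_sum, Finset.sum_mul]
  refine Finset.sum_congr rfl fun j _ => ?_
  rw [orbit_rpow_add_nat_mul]
  ring

/-- The integrand of the `n`-th difference is integrable on the ray. -/
theorem integrable_orbit_rpow_mul_one_sub_pow_mul_sph {k lam : ℝ} (hk : 1 < k) (h1 : lam < k)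
    (h2 : 2 < k + lam) {h : ℝ} (hh : 0 ≤ h) (n : ℕ) :
    Integrable (fun g => (1 - ‖orbit g‖ ^ 2) ^ (k / 2) * (1 - (1 - ‖orbit g‖ ^ 2) ^ (h / 2)) ^ n
      * sph lam g) (nu haarCircle) := by
  have hi : ∀ j ∈ range (n + 1), Integrable (fun g => (-1 : ℝ) ^ j * (n.choose j : ℝ)
      * ((1 - ‖orbit g‖ ^ 2) ^ ((k + j * h) / 2) * sph lam g)) (nu haarCircle) := fun j _ => by
    have hjh : 0 ≤ (j : ℝ) * h := mul_nonneg (Nat.cast_nonneg j) hh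
    exact (integrable_orbit_rpow_mul_sph (by linarith) (by linarith) (by linarith)).const_mul _
  have := integrable_finsetSum (range (n + 1)) hi
  refine this.congr (Filter.Eventually.of_forall fun g => ?_)
  simp only
  exact sum_orbit_rpow_shift_eq k h lam n g

/-- **THE `n`-TH FORWARD DIFFERENCE OF THE JACOBI TRANSFORM IN THE WEIGHT**: for `k` on the ray and
`h ≥ 0`, `(−1)^n · Δ_h^n m̂_·(λ)(k) = ∫_G m_k (1 − m_h)^n φ_λ dν`. -/
theorem jacobi_fwdDiff_iter_eq {k lam : ℝ} (hk : 1 < k) (h1 : lam < k) (h2 : 2 < k + lam)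
    {h : ℝ} (hh : 0 ≤ h) (n : ℕ) :
    (-1 : ℝ) ^ n * ((fwdDiff h)^[n] (fun k => ∫ g, (1 - ‖orbit g‖ ^ 2) ^ (k / 2) * sph lam g
        ∂(nu haarCircle)) k)
      = ∫ g, (1 - ‖orbit g‖ ^ 2) ^ (k / 2) * (1 - (1 - ‖orbit g‖ ^ 2) ^ (h / 2)) ^ n * sph lam g
          ∂(nu haarCircle) := by
  have hi : ∀ j ∈ range (n + 1), Integrable (fun g => (-1 : ℝ) ^ j * (n.choose j : ℝ)
      * ((1 - ‖orbit g‖ ^ 2) ^ ((k + j * h) / 2) * sph lam g)) (nu haarCircle) := fun j _ => by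
    have hjh : 0 ≤ (j : ℝ) * h := mul_nonneg (Nat.cast_nonneg j) hh
    exact (integrable_orbit_rpow_mul_sph (by linarith) (by linarith) (by linarith)).const_mul _
  rw [fwdDiff_iter_eq_sum_shift, Finset.mul_sum]
  rw [← integral_congr_ae (Filter.Eventually.of_forall fun g => sum_orbit_rpow_shift_eq k h lam n g),
    integral_finsetSum _ hi]
  refine Finset.sum_congr rfl fun j hj => ?_
  rw [Finset.mem_range] at hj
  rw [integral_const_mul, zsmul_eq_mul, nsmul_eq_mul]
  push_cast
  have hsign : (-1 : ℝ) ^ n * (-1) ^ (n - j) = (-1) ^ j := by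
    obtain ⟨m, rfl⟩ : ∃ m, n = j + m := ⟨n - j, by omega⟩
    rw [Nat.add_sub_cancel_left, pow_add, mul_assoc, ← pow_add, ← two_mul, pow_mul, neg_one_sq,
      one_pow, mul_one]
  rw [← mul_assoc, ← mul_assoc, hsign]

/-- **COMPLETE MONOTONICITY (HBW FORM)**: `(−1)^n · Δ_h^n m̂_·(λ)(k) ≥ 0` on the ray, for every `h ≥ 0`
and every `n`. -/
theorem jacobi_fwdDiff_iter_nonneg {k lam : ℝ} (hk : 1 < k) (h1 : lam < k) (h2 : 2 < k + lam)
    {h : ℝ} (hh : 0 ≤ h) (n : ℕ) :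
    0 ≤ (-1 : ℝ) ^ n * ((fwdDiff h)^[n] (fun k => ∫ g, (1 - ‖orbit g‖ ^ 2) ^ (k / 2) * sph lam g
        ∂(nu haarCircle)) k) := by
  rw [jacobi_fwdDiff_iter_eq hk h1 h2 hh n]
  refine integral_nonneg fun g => ?_
  exact mul_nonneg (mul_nonneg (orbit_rpow_nonneg k g)
    (pow_nonneg (sub_nonneg.mpr (orbit_rpow_le_one hh g)) n)) (sph_pos lam g).le

/-- **Strictly**: `(−1)^n · Δ_h^n m̂_·(λ)(k) > 0` for `h > 0` (the integrand is positive on the open set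
`{g·0 ≠ 0}` of positive Haar measure). -/
theorem jacobi_fwdDiff_iter_pos {k lam : ℝ} (hk : 1 < k) (h1 : lam < k) (h2 : 2 < k + lam)
    {h : ℝ} (hh : 0 < h) (n : ℕ) :
    0 < (-1 : ℝ) ^ n * ((fwdDiff h)^[n] (fun k => ∫ g, (1 - ‖orbit g‖ ^ 2) ^ (k / 2) * sph lam g
        ∂(nu haarCircle)) k) := by
  rw [jacobi_fwdDiff_iter_eq hk h1 h2 hh.le n]
  have hnn : 0 ≤ fun g : SU11 => (1 - ‖orbit g‖ ^ 2) ^ (k / 2)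
      * (1 - (1 - ‖orbit g‖ ^ 2) ^ (h / 2)) ^ n * sph lam g := fun g =>
    mul_nonneg (mul_nonneg (orbit_rpow_nonneg k g)
      (pow_nonneg (sub_nonneg.mpr (orbit_rpow_le_one hh.le g)) n)) (sph_pos lam g).le
  rw [integral_pos_iff_support_of_nonneg hnn
    (integrable_orbit_rpow_mul_one_sub_pow_mul_sph hk h1 h2 hh.le n)]
  refine lt_of_lt_of_le nu_orbit_ne_zero_pos (measure_mono fun g hg => ?_)
  simp only [mem_setOf_eq] at hg
  simp only [Function.mem_support, ne_eq]
  exact (mul_pos (mul_pos (Real.rpow_pos_of_pos (one_sub_norm_orbit_sq_pos g) _)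
    (pow_pos (sub_pos.mpr (orbit_rpow_lt_one hh hg)) n)) (sph_pos lam g)).ne'

/-! ### The orders `n = 1, 2`: monotone and convex in the weight -/

/-- Order `1`: `m̂_k(λ) − m̂_{k+h}(λ) = ∫_G m_k (1 − m_h) φ_λ dν ≥ 0`. -/
theorem jacobi_first_difference_nonneg {k lam : ℝ} (hk : 1 < k) (h1 : lam < k) (h2 : 2 < k + lam)
    {h : ℝ} (hh : 0 ≤ h) :
    0 ≤ ∫ g, (1 - ‖orbit g‖ ^ 2) ^ (k / 2) * sph lam g ∂(nu haarCircle)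
      - ∫ g, (1 - ‖orbit g‖ ^ 2) ^ ((k + h) / 2) * sph lam g ∂(nu haarCircle) := by
  have := jacobi_fwdDiff_iter_nonneg hk h1 h2 hh 1
  simp only [Function.iterate_one, fwdDiff, pow_one, neg_one_mul, neg_sub] at this
  exact this

/-- Order `2`: the second difference `m̂_{k+2h}(λ) − 2 m̂_{k+h}(λ) + m̂_k(λ) ≥ 0` — the transform is
convex in the weight. -/
theorem jacobi_second_difference_nonneg {k lam : ℝ} (hk : 1 < k) (h1 : lam < k) (h2 : 2 < k + lam)
    {h : ℝ} (hh : 0 ≤ h) :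
    0 ≤ ∫ g, (1 - ‖orbit g‖ ^ 2) ^ ((k + 2 * h) / 2) * sph lam g ∂(nu haarCircle)
      - 2 * ∫ g, (1 - ‖orbit g‖ ^ 2) ^ ((k + h) / 2) * sph lam g ∂(nu haarCircle)
      + ∫ g, (1 - ‖orbit g‖ ^ 2) ^ (k / 2) * sph lam g ∂(nu haarCircle) := by
  have := jacobi_fwdDiff_iter_nonneg hk h1 h2 hh 2
  simp only [Function.iterate_succ, Function.iterate_zero, Function.comp_apply, id_eq, fwdDiff,
    neg_one_sq, one_mul] at this
  rw [show k + 2 * h = k + h + h by ring]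
  linarith

/-- **THE JACOBI TRANSFORM IS CONVEX IN THE WEIGHT** on the ray `k > max(1, λ, 2 − λ)`: from the
log-convexity (`convexOn_log_jacobi_weight`, Hölder) by the weighted AM–GM inequality
`m̂_{k₁}^a m̂_{k₂}^b ≤ a m̂_{k₁} + b m̂_{k₂}`. -/
theorem convexOn_jacobi_weight (lam : ℝ) :
    ConvexOn ℝ (Ioi (max 1 (max lam (2 - lam))))
      (fun k => ∫ g, (1 - ‖orbit g‖ ^ 2) ^ (k / 2) * sph lam g ∂(nu haarCircle)) := by
  refine convexOn_iff_forall_pos.mpr ⟨convex_Ioi _, fun x hx y hy a b ha hb hab => ?_⟩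
  rw [Set.mem_Ioi, max_lt_iff, max_lt_iff] at hx hy
  simp only [smul_eq_mul]
  have hxpos := jacobi_pos hx.1 hx.2.1 (by linarith [hx.2.2])
  have hypos := jacobi_pos hy.1 hy.2.1 (by linarith [hy.2.2])
  calc ∫ g, (1 - ‖orbit g‖ ^ 2) ^ ((a * x + b * y) / 2) * sph lam g ∂(nu haarCircle)
      ≤ (∫ g, (1 - ‖orbit g‖ ^ 2) ^ (x / 2) * sph lam g ∂(nu haarCircle)) ^ a
        * (∫ g, (1 - ‖orbit g‖ ^ 2) ^ (y / 2) * sph lam g ∂(nu haarCircle)) ^ b :=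
        jacobi_mul_add_mul_le hx.1 hx.2.1 (by linarith [hx.2.2]) hy.1 hy.2.1 (by linarith [hy.2.2])
          ha hb hab
    _ ≤ a * ∫ g, (1 - ‖orbit g‖ ^ 2) ^ (x / 2) * sph lam g ∂(nu haarCircle)
        + b * ∫ g, (1 - ‖orbit g‖ ^ 2) ^ (y / 2) * sph lam g ∂(nu haarCircle) :=
        Real.geom_mean_le_arith_mean2_weighted ha.le hb.le hxpos.le hypos.le hab

end measure

end Summit.Ventures.HodgeRepro2.T5SU11JacobiCompleteMonotone
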